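import Literature.NumberTheory.Automorphic.Liu2021.AppendixC.IsogenyDescentOfLevelQuotient
import Literature.NumberTheory.Automorphic.Liu2021.AppendixC.AlbaneseTraceOfFiniteQuotientOfCocycle
import HarnessLib

/-!
# [Liu2021, Thm. 4.18 (1)] input (D), UNCONDITIONALLY in the Albanese trace: descent up to isogeny of `K`-invariant
# homomorphisms on `A_N = Alb(X_N)` from the level quotient property alone

[Liu2021] = Yifeng Liu, *Fourier–Jacobi cycles and arithmetic relative trace formula*, Camb. J. Math. **9** (2021).  PROOF FILE
(theorems only; no definition, no named fact, no instance).  Cell hodgecm-mathlib, fan B, rows VI-4/VI-5, file F5 of the VI-5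
discharge (B-p16, 2026-08-28): the tree's `Sec42Data.HeckeTranslates.isogenyDescent_of_levelQuotient`
(`AppendixC/IsogenyDescentOfLevelQuotient.lean`) takes the named fact `AlbaneseTraceOfFiniteQuotient.{0}` (Lang VIII §6 Thm. 13)
as a hypothesis `hAT`; here that hypothesis is DISCHARGED, because the base field `E` of the §4.2 datum is a number field, hence
embeds into `ℂ`, and the Albanese trace of a finite quotient is PROVED for smooth projective varieties over subfields of `ℂ`
(`Albanese.exists_trace_of_isSepQuotient_complex`, file `AppendixC/AlbaneseTraceOfFiniteQuotientOfCocycle.lean`: miracle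
flatness of the quotient, the `(Δ × Δ)`-invariant extension of `α_X ≫ Σ_g Alb_g`, and descent along `p × p`).

* `Albanese.exists_map_comp_eq_zsmul_of_isSepQuotient_complex` — `Albanese.exists_map_comp_eq_zsmul_of_isSepQuotient` without
  the hypothesis `hT`, for `k ⊂ ℂ` (`k : Type`).
* `Sec42Data.HeckeTranslates.isogenyDescent_of_levelQuotient_holds` — `isogenyDescent_of_levelQuotient` without `hAT` (same
  proof, verbatim, with the last step replaced).

HC_CM is proved only modulo the 7 printed citations until rung 0 closes; nothing here discharges a COR-CM binder by itself (the
level quotient property `hq` remains a hypothesis, discharged elsewhere: `levelQuotient_printed`).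

## References
* [Liu2021] Y. Liu, arXiv:2102.11518 = Camb. J. Math. 9 (2021), Thm. 4.18 (1) (l. 2239), §4.2 (l. 2064–2074).
* [Lang1983AbelianVarieties] S. Lang, *Abelian Varieties*, Ch. VIII §6 Thm. 13 (pp. 224–227).
* [Milne2005ShimuraVarieties] J. S. Milne, *Introduction to Shimura varieties* (2005), Rem. 5.29 (c).
-/

set_option autoImplicit false

noncomputable section

open CategoryTheory AlgebraicGeometry NumberField
open Literature.AlgebraicGeometry.Motives (SchemeOver AbelianVariety IsProjectiveOver IsSepQuotient)

namespace Literature.NumberTheory.Automorphic.Liu2021.AppendixC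

universe v

/-- **Invariant homomorphisms on `Alb_X` descend to `Alb_{X/Δ}` up to `|Δ|`, unconditionally over subfields of `ℂ`.**  For
`k ⊂ ℂ` of characteristic zero, `Δ` finite acting on the smooth projective `X`, `p : X ⟶ Y` a quotient for separated test
objects (`Y` smooth projective), Albanese data `aX`, `aY`, and a homomorphism `φ : Alb_X ⟶ B` with `Alb_{act g} ≫ φ = φ`:
`Alb_p ≫ ψ = m • φ` for some `ψ` and `m ≠ 0` (the trace exists by `Albanese.exists_trace_of_isSepQuotient_complex`).
[cite: Lang1983AbelianVarieties, Ch. VIII §6 Thm. 13, pp. 224–227] -/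
theorem Albanese.exists_map_comp_eq_zsmul_of_isSepQuotient_complex {k : Type} [Field k] [CharZero k] [Algebra k ℂ]
    {X Y : SchemeOver k} {dX dY : ℕ} [SmoothOfRelativeDimension dX X.hom] [SmoothOfRelativeDimension dY Y.hom]
    (hX : IsProjectiveOver X) (hY : IsProjectiveOver Y)
    {Δ : Type v} [Group Δ] [Fintype Δ] (act : Δ →* Aut X) (p : X ⟶ Y) (hp : IsSepQuotient (fun g => act g) p)
    (aX : Albanese X) (aY : Albanese Y) {B : AbelianVariety k} (φ : aX.Alb ⟶ B)
    (hφ : ∀ g : Δ, aX.map aX (act g).hom ≫ φ = φ) :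
    ∃ (m : ℤ) (ψ : aY.Alb ⟶ B), m ≠ 0 ∧ aX.map aY p ≫ ψ = m • φ := by
  obtain ⟨t, ht⟩ := Albanese.exists_trace_of_isSepQuotient_complex (dX := dX) (dY := dY) hX hY act p hp aX aY
  exact Albanese.exists_map_comp_eq_zsmul_of_trace aX aY (fun g => aX.map aX (act g).hom) p t ht φ hφ

variable {F E : Type} [Field F] [NumberField F] [IsTotallyReal F] [Field E] [NumberField E] [Algebra F E]
  [IsTotallyComplex E] [Algebra.IsQuadraticExtension F E]
variable {P5 : PropC5Data F E} {isotropicAt : ℕ → Prop}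

/-- **Input (D) of [Liu2021, Thm. 4.18 (1)] from the level quotient property ALONE** (the Albanese trace of a finite quotient being
proved over the number field `E ⊂ ℂ`): for a §4.2 datum `C` with Hecke translates `T` whose transition morphisms
`u^N_K : X_N ⟶ X_K` (`N ≤ K` sufficiently small, `N` normal in `K`) are quotients of `X_N` by the translates `T_k`, `k ∈ K`, for
separated test objects, `T.IsogenyDescent` holds: every `φ : A_N ⟶ B` with `Alb(T_k) ≫ φ = φ` has `Alb_{u^N_K} ≫ ψ = m • φ`,
`m ≠ 0`.  Same proof as `isogenyDescent_of_levelQuotient`, the named fact replaced by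
`Albanese.exists_map_comp_eq_zsmul_of_isSepQuotient_complex`. [cite: Liu2021, Thm. 4.18 (1) FJcycle.tex l. 2239 and §4.2 l. 2064–2074]
[cite: Milne2005ShimuraVarieties, Rem. 5.29 (c) p. 65] [cite: Lang1983AbelianVarieties, Ch. VIII §6 Thm. 13, pp. 224–227] -/
theorem Sec42Data.HeckeTranslates.isogenyDescent_of_levelQuotient_holds {C : Sec42Data P5 isotropicAt}
    (T : C.HeckeTranslates)
    (hq : ∀ ⦃N K : C5.SmallLevel C.S.K₀⦄ (h : N ≤ K) (hn : ∀ k ∈ K.1.1, C5.HeckeLE k N N)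
      (W : SchemeOver E) (f : C.X N ⟶ W), IsSeparated W.hom →
      (∀ (k : C.G) (hk : k ∈ K.1.1), T.tr k N N (hn k hk) ≫ f = f) →
      ∃! fbar : C.X K ⟶ W, C.cpt.X.map (homOfLE h) ≫ fbar = f) :
    T.IsogenyDescent := by
  intro N K h hn B φ hφ
  classical
  -- the compact group `K`, its open normal subgroup `N`, and the finite group `Δ = K/N`
  let Kg : Subgroup C.G := K.1.1
  let Ng : Subgroup Kg := N.1.1.subgroupOf K.1.1
  have hmemNg : ∀ x : Kg, x ∈ Ng ↔ (x : C.G) ∈ N.1.1 := fun x => Subgroup.mem_subgroupOf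
  haveI hNn : Ng.Normal := ⟨fun n hn' g => by
    rw [hmemNg] at hn' ⊢
    have h1 := hn (g⁻¹ : Kg) (g⁻¹).2 (n : C.G) hn'
    simpa only [Subgroup.coe_inv, inv_inv, Subgroup.coe_mul] using h1⟩
  haveI : CompactSpace Kg := isCompact_iff_compactSpace.1 K.1.2.2
  have hNo : IsOpen (Ng : Set Kg) := N.1.2.1.preimage continuous_subtype_val
  haveI : Finite (Kg ⧸ Ng) := Subgroup.quotient_finite_of_isOpen Ng hNo
  letI : Fintype (Kg ⧸ Ng) := Fintype.ofFinite _
  -- the translates `T_k`, `k ∈ K`, as automorphisms of `X_N`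
  have hinv : ∀ {k : C.G}, k ∈ K.1.1 → k⁻¹ ∈ K.1.1 := fun hk => K.1.1.inv_mem hk
  have htr1 : ∀ (g : C.G) (hg : g = 1) (hh : C5.HeckeLE g N N), T.tr g N N hh = 𝟙 (C.X N) := by
    rintro g rfl hh
    exact T.tr_self N.1.1.one_mem
  let trI : ∀ k : C.G, k ∈ K.1.1 → (C.X N ≅ C.X N) := fun k hk =>
    { hom := T.tr k N N (hn k hk)
      inv := T.tr k⁻¹ N N (hn k⁻¹ (hinv hk))
      hom_inv_id := by rw [T.tr_mul]; exact htr1 _ (mul_inv_cancel k) _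
      inv_hom_id := by rw [T.tr_mul]; exact htr1 _ (inv_mul_cancel k) _ }
  have trI_hom : ∀ (k : C.G) (hk : k ∈ K.1.1), (trI k hk).hom = T.tr k N N (hn k hk) := fun _ _ => rfl
  -- the action `k ↦ T_{k⁻¹}` of `K` on `X_N` (a homomorphism into `Aut X_N`, whose multiplication is reversed composition)
  let actK : Kg →* Aut (C.X N) :=
    { toFun := fun k => trI ((k : C.G)⁻¹) (hinv k.2)
      map_one' := Iso.ext (by
        change T.tr ((1 : Kg) : C.G)⁻¹ N N _ = 𝟙 (C.X N)
        exact htr1 _ (by simp) _)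
      map_mul' := fun a b => Iso.ext (by
        change T.tr ((a : C.G) * b)⁻¹ N N _ = T.tr (b : C.G)⁻¹ N N _ ≫ T.tr (a : C.G)⁻¹ N N _
        rw [T.tr_mul]
        exact T.tr_congr (mul_inv_rev _ _) _ _) }
  have actK_hom : ∀ k : Kg, (actK k).hom = T.tr (k : C.G)⁻¹ N N (hn _ (hinv k.2)) := fun _ => rfl
  -- it is trivial on `N`, hence descends to `Δ = K/N`
  have hker : ∀ n ∈ Ng, actK n = 1 := fun n hn' => Iso.ext (by
    rw [actK_hom]
    exact T.tr_self (N.1.1.inv_mem ((hmemNg n).1 hn')))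
  let act : (Kg ⧸ Ng) →* Aut (C.X N) := QuotientGroup.lift Ng actK hker
  have act_mk : ∀ k : Kg, (act (QuotientGroup.mk k)).hom = T.tr (k : C.G)⁻¹ N N (hn _ (hinv k.2)) := fun _ => rfl
  -- `u^N_K` is a quotient of `X_N` by this action for separated test objects
  have hu : C.cpt.X.map (homOfLE h) = T.tr 1 N K (C5.HeckeLE.one_of_le h) := (T.tr_one (homOfLE h)).symm
  have hp : IsSepQuotient (fun g => act g) (C.cpt.X.map (homOfLE h)) := by
    refine ⟨fun g => ?_, fun W f hW hf => hq h hn W f hW fun k hk => ?_⟩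
    · obtain ⟨k, rfl⟩ := QuotientGroup.mk_surjective g
      rw [act_mk, hu, T.tr_mul]
      conv_rhs => rw [← Category.comp_id (T.tr 1 N K _), ← T.tr_self (K := K) (hinv k.2), T.tr_mul]
      exact T.tr_congr (by simp) _ _
    · have h1 := hf (QuotientGroup.mk ⟨k⁻¹, hinv hk⟩)
      rw [act_mk] at h1
      rw [T.tr_congr (inv_inv k).symm (hn k hk) (hn _ (hinv (hinv hk)))]
      exact h1
  -- the invariance of `φ` under the action, through `Alb`
  have hφ' : ∀ g : Kg ⧸ Ng, (C.alb N).map (C.alb N) (act g).hom ≫ φ = φ := by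
    intro g
    obtain ⟨k, rfl⟩ := QuotientGroup.mk_surjective g
    rw [act_mk]
    exact hφ (k : C.G)⁻¹ (hinv k.2)
  -- conclude by the descent along the finite quotient
  haveI := C.cpt.smooth_X N
  haveI := C.cpt.smooth_X K
  letI : Algebra E ℂ := ((IsAlgClosed.lift : E →ₐ[ℚ] ℂ) : E →+* ℂ).toAlgebra
  obtain ⟨m, ψ, hm, hψ⟩ := Albanese.exists_map_comp_eq_zsmul_of_isSepQuotient_complex (dX := P5.n - 1)
    (dY := P5.n - 1) (C.cpt.projective_X N) (C.cpt.projective_X K) act (C.cpt.X.map (homOfLE h)) hp (C.alb N)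
    (C.alb K) φ hφ'
  refine ⟨m, ψ, hm, ?_⟩
  rw [C.Atr_eq_map (homOfLE h)]
  exact hψ

end Literature.NumberTheory.Automorphic.Liu2021.AppendixC

end
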